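import Literature.Analysis.FluidPDE.AxisymmetricTypeIAxis
import Literature.Analysis.FluidPDE.AxisymmetricL3OffTube
import Literature.Analysis.FluidPDE.AxisymPoloidalPart
import Literature.Analysis.FluidPDE.KNSSTypeIIHolds
import Literature.Analysis.FluidPDE.KNSSTypeIRateRescaling
import Literature.Barriers.NavierStokesRegularity.AxisymmetricTypeIExclusionProofs
import HarnessLib

/-!
# Seregin–Šverák 2009, Theorem 1.1 with the Type I rate on the meridional velocity only

G. Seregin, V. Šverák, *On Type I singularities of the local axi-symmetric solutions of the
Navier–Stokes equations*, Comm. PDE 34 (2009) 171–201 = arXiv:0804.1803. In §1 (arXiv p. 2) the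
paper fixes, "with the `x₃`-axis as the axis of symmetry", the hypothesis

> (1.1) `sup_{(x,t) ∈ Q(z₀,R)} √(t₀ - t) |v̄(x,t)| < +∞` for some `R > 0`, "where `z₀` lies on the
> `x₃`-axis and we denote by `v̄(x,t)` the projection of the velocity vector `v(x,t)` into the
> plane passing through `x` and the axis of symmetry `x₃`"

(that is, `v̄ = v_ϱ e_ϱ + v₃ e₃`, §3 p. 9), and states (p. 3):

> **Theorem 1.1.** Assume that `v ∈ L₃(Q(z₀,R))` is an axially symmetric weak solution to the
> Navier–Stokes equations in `Q(z₀,R)` such that there exists an associated pressure field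
> `q ∈ L_{3/2}(Q(z₀,R))`. If, in addition, `v` satisfies (1.1), then `z₀` is a regular point of `v`.

The tree formalises the paper's §3–§4 (some seventy `SereginSverak*` files) in the form in which
§3 restates the result on the canonical domain `Q = 𝒞 × ]-1,0[`, Thm. 3.1 with (r3)
`|v(x,t)| ≤ C/√(-t)` — the bound carried by the FULL velocity (`SereginSverak2009.IsTypeIOnCyl`,
barrier `Literature.Barriers.NavierStokesRegularity.AxisymmetricTypeIExclusion`, DISCHARGED as
`AxisymmetricTypeIExclusion_holds`). The §1 statement is sharper: only the meridional part `v̄`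
carries the rate, the swirl `v̂ = v_φ e_φ` being controlled inside the proof by Lemma 3.3
(`|x'||v_φ| ≤ C₂` on `Q(1/2)` under hypothesis (r2) `v ∈ L_∞(𝒞 × ]-1,-a²[)`, `0 < a < 1`) — see the
proof of Lemma 3.5, (as7)–(as9), p. 9, where `v̄` is estimated through the rate and `v̂` through
Lemma 3.3, and Prop. 3.7. This file vendors the §1 statement as ONE named fact, on the canonical
domain (the paper: "We reformulate our main results for these canonical domains. The general
case is obtained by re-scaling", p. 9) and WITH hypothesis (r2) kept explicit (Lemma 3.3 is
invoked under it; under the full-velocity rate (r2) is automatic,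
`SereginSverak2009.isBoundedAwayFromZero_of_isTypeIOnCyl`; keeping it makes the declaration
weaker than, hence implied by, the printed Theorem 1.1):

* `SereginSverak2009.IsMeridionalTypeIOnCyl u` — hypothesis (1.1) on `Q`: `√(-t) ‖ū(t,x)‖ ≤ C`
  a.e., `ū = poloidalPart (u t)` (the tree's name for `v̄`, `AxisymPoloidalPart.lean`);
* `SereginSverak2009.MeridionalTypeIRegularity` — **the named fact**: standing assumptions of §3
  with axial symmetry (`IsAxisymmetricLocalSolution`) + (r2) (`IsBoundedAwayFromZero`) + (1.1)
  ⇒ `IsRegularAtOrigin`. Nothing is asserted; users take `(h : MeridionalTypeIRegularity)`.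

PROVED here (no further facts; net debt of the file = +1):

* `isMeridionalTypeIOnCyl_of_isTypeIOnCyl` (`‖ū‖ ≤ ‖u‖`), hence
  `MeridionalTypeIRegularity.isRegularAtOrigin_of_typeI` (the fact implies Thm. 3.1 in the
  tree's full-velocity form) and `MeridionalTypeIRegularity.axisymmetricTypeIExclusion` (the fact
  implies the catalogued barrier) — so the new statement is a common strengthening of what the
  tree has discharged, not a variant beside it;
* the CLASSICAL reading (the one numerical blow-up candidates are measured against):
  `MeridionalTypeIRegularity.isBoundedNearTop_axis` — for a classical finite-energy axisymmetric
  solution on `[0, T)`, bounded on sub-slabs, a Type I rate `√(T-t)‖ū(t,x)‖ ≤ C` on the POLOIDAL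
  part alone makes every axis point a point of local boundedness at time `T` (the viscosity-
  normalising parabolic zoom of `AxisymmetricTypeIAxis.lean` run on the Type-I-free data of
  `AxisymmetricL3Hyp`; (r2) from the sub-slab bounds; `e_θ` is invariant under the zoom about an
  axis point, `poloidalPart_axis_zoom`); with the tree's off-axis and spatial-infinity inputs
  (`axisymmetricL3_boundedNearTop_offAxis`, `axisymmetricL3_boundedNearTop_infinity`, no Type I
  needed) and the continuation of bounded Leray–Hopf solutions
  (`hasSmoothExtensionPast_of_bounded_holds`): `MeridionalTypeIRegularity.hasSmoothExtensionPast`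
  — NO BLOW-UP AT `T` UNDER A TYPE I RATE ON `u_pol` ONLY — and its `IsTypeIBlowup` spelling
  `MeridionalTypeIRegularity.hasSmoothExtensionPast_of_isTypeIBlowup_poloidal`.

Companion (kernel, no fact): `KNSSPoloidalAxisDecay.lean` — the `C/r` form (Thm. 1.2) on the
poloidal part for classical solutions with bounded initial circulation follows from the tree's
full-velocity theorem and the swirl maximum principle; the RATE form here does not (near the axis
`|v_φ| ≤ ‖Γ₀‖_∞/r` is not a Type I bound), which is why Theorem 1.1 (§1) is vendored.

WHAT THIS IS NOT: not a claim about Navier–Stokes blow-up; a printed regularity criterion as a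
named `Prop` plus kernel corollaries conditional on it.

## References

* G. Seregin, V. Šverák, Comm. PDE 34 (2009) 171–201, arXiv:0804.1803: §1 p. 2 (1.1)–(1.2) and
  the definition of `v̄`, p. 3 Thm. 1.1–1.3; §3 p. 9 (`v̄ = v_ϱe_ϱ + v₃e₃`, `v̂ = v_φ e_φ`,
  Thm. 3.1 (r3), Thm. 3.2 (r2)/(r4), Lemma 3.3 (as1)), pp. 9–10 (Lemma 3.5, (as6)–(as9);
  Prop. 3.7 (as14)), §4 p. 11. [`SereginSverak2009`]
* G. Koch, N. Nadirashvili, G. Seregin, V. Šverák, Acta Math. 203 (2009) 83–105, Thms. 6.1–6.2.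
  [`KochNadirashviliSereginSverak2009`]
-/

noncomputable section

open MeasureTheory Set Function Filter Topology TopologicalSpace Metric
open scoped NNReal ENNReal

namespace Literature.Analysis.FluidPDE

open Literature.Barriers.NavierStokesRegularity

namespace SereginSverak2009

/-! ### Hypothesis (1.1): the Type I rate on the meridional part -/

/-- **Hypothesis (1.1) of Seregin–Šverák 2009 on the canonical cylinder**: the Type I rate is
carried by the meridional (poloidal) part `v̄ = v_ϱ e_ϱ + v₃ e₃ = poloidalPart v` only,
`√(-t) ‖v̄(x,t)‖ ≤ C` for a.e. `z = (t, x) ∈ Q = Q(0,1)` (junk-free product form, as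
`IsTypeIOnCyl`). [cite: SereginSverak2009, §1 (1.1) (arXiv p. 2) and §3 p. 9 (definition of v̄)] -/
def IsMeridionalTypeIOnCyl
    (u : ℝ → EuclideanSpace ℝ (Fin 3) → EuclideanSpace ℝ (Fin 3)) : Prop :=
  ∃ C : ℝ, ∀ᵐ z ∂(volume.restrict (parCyl 0 1)),
    Real.sqrt (-z.1) * ‖poloidalPart (u z.1) z.2‖ ≤ C

/-- The full-velocity rate (r3) of Thm. 3.1 implies (1.1) (`‖v̄‖ ≤ ‖v‖`, `norm_poloidalPart_le`).
[cite: SereginSverak2009, §1 (1.1) and §3 Thm. 3.1 (r3)] -/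
theorem isMeridionalTypeIOnCyl_of_isTypeIOnCyl
    {u : ℝ → EuclideanSpace ℝ (Fin 3) → EuclideanSpace ℝ (Fin 3)} (h : IsTypeIOnCyl u) :
    IsMeridionalTypeIOnCyl u := by
  obtain ⟨C, hC⟩ := h
  refine ⟨C, hC.mono fun z hz => le_trans ?_ hz⟩
  exact mul_le_mul_of_nonneg_left (norm_poloidalPart_le _ _) (Real.sqrt_nonneg _)

/-! ### The named fact: Theorem 1.1 of §1 -/

/-- **Seregin–Šverák 2009, Theorem 1.1 (§1, arXiv p. 3), on the canonical domain, with the rate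
on the meridional part `v̄` only (hypothesis (1.1), p. 2).** Let `(u, p)` satisfy the standing
assumptions of §3 with axial symmetry (`IsAxisymmetricLocalSolution u p`: Navier–Stokes with
`ν = 1`, `f = 0` in the sense of distributions in `Q = 𝒞 × ]-1,0[`, `u ∈ L³(Q)`,
`p ∈ L^{3/2}(Q)`, every slice axisymmetric about the `x₃`-axis), hypothesis (r2)
(`IsBoundedAwayFromZero u`: `u ∈ L_∞(𝒞 × ]-1,-a²[)` for each `0 < a < 1` — kept explicit, see
the module docstring: Lemma 3.3 is invoked under it in the proof of Lemma 3.5) and (1.1)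
(`IsMeridionalTypeIOnCyl u`: `√(-t)‖ū(t,x)‖ ≤ C` a.e. in `Q`). Then the origin is a regular point
(`IsRegularAtOrigin u`: `u ∈ L^∞(Q(r))` for some `r > 0`). PRINTED PROOF: Lemma 3.3 (swirl bound
`|x'||v_φ| ≤ C₂` on `Q(1/2)`), Lemma 3.5 (scaled energies bounded along the axis: `v̂` through
(as7)–(as8), `v̄` through the rate (as9), Young (as11), iteration with the local energy
inequality (as12) and the pressure decay (as13)), Prop. 3.7 (`|v| ≤ C₁/|x'|` on `Q(1/8)`), and
the blow-up argument of §4 closed by the Liouville theorem of KNSS 2009, Thm. 5.3. With the rate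
on the full velocity this is the tree's `isRegularAtOrigin_of_typeI` / barrier
`AxisymmetricTypeIExclusion` (DISCHARGED); the present meridional form implies that one
(`MeridionalTypeIRegularity.axisymmetricTypeIExclusion`) and is NOT asserted: users take
`(h : MeridionalTypeIRegularity)`.
[cite: SereginSverak2009, Thm 1.1 (arXiv p. 3) with (1.1) (p. 2); proof §3 Lemmas 3.3, 3.5, Prop 3.7, §4] -/
def MeridionalTypeIRegularity : Prop :=
  ∀ (u : ℝ → EuclideanSpace ℝ (Fin 3) → EuclideanSpace ℝ (Fin 3))
    (p : ℝ → EuclideanSpace ℝ (Fin 3) → ℝ),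
    IsAxisymmetricLocalSolution u p → IsBoundedAwayFromZero u → IsMeridionalTypeIOnCyl u →
      IsRegularAtOrigin u

/-- **The meridional form implies Thm. 3.1 in the tree's full-velocity form**: under the standing
assumptions with axial symmetry, the rate (r3) on `|v|` gives (r2)
(`isBoundedAwayFromZero_of_isTypeIOnCyl`) and (1.1) (`isMeridionalTypeIOnCyl_of_isTypeIOnCyl`).
[cite: SereginSverak2009, Thm 3.1 (= Thm 1.1), arXiv pp. 3, 9] -/
theorem MeridionalTypeIRegularity.isRegularAtOrigin_of_typeI (h : MeridionalTypeIRegularity)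
    {u : ℝ → EuclideanSpace ℝ (Fin 3) → EuclideanSpace ℝ (Fin 3)}
    {p : ℝ → EuclideanSpace ℝ (Fin 3) → ℝ} (hsol : IsAxisymmetricLocalSolution u p)
    (hI : IsTypeIOnCyl u) : IsRegularAtOrigin u :=
  h u p hsol (isBoundedAwayFromZero_of_isTypeIOnCyl hI) (isMeridionalTypeIOnCyl_of_isTypeIOnCyl hI)

/-- **The meridional form implies the catalogued barrier** `AxisymmetricTypeIExclusion`
(Seregin–Šverák 2009, Thm. 3.1 in the barrier's phrasing), through the dictionary
`ssCylinder = parCyl 0 1`, `Q_r(0,0) ⊆ Q(r)` of `AxisymmetricTypeIExclusionProofs.lean`.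
[cite: SereginSverak2009, Thm 3.1 (= Thm 1.1) and §3] -/
theorem MeridionalTypeIRegularity.axisymmetricTypeIExclusion (h : MeridionalTypeIRegularity) :
    AxisymmetricTypeIExclusion := by
  intro u p hsol hu3 hp haxi hI
  rw [ssCylinderOpens_eq_parCylOpens] at hsol
  rw [ssCylinder_eq_parCyl] at hu3 hp hI
  exact exists_eLpNorm_parabolicCylinder_lt_top_of_isRegularAtOrigin
    (h.isRegularAtOrigin_of_typeI ⟨hsol, hu3, hp, haxi⟩ hI)

end SereginSverak2009

/-! ### The zoom about an axis point preserves the cylindrical frame -/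

section Zoom

open SereginSverak2009

/-- Coordinates of `x₀ + R • y` for `x₀` on the axis: the horizontal ones are those of `R • y`.
[cite: SereginSverak2009, §4 p. 11 (the rescaling u^k(y,s) = λ_k v(λ_k y', x_{3k} + λ_k y₃, t_k + λ_k² s))] -/
private theorem apply_axis_add_smul {x₀ : EuclideanSpace ℝ (Fin 3)} (hx₀ : cylRadius x₀ = 0) (R : ℝ)
    (y : EuclideanSpace ℝ (Fin 3)) :
    (x₀ + R • y) 0 = R * y 0 ∧ (x₀ + R • y) 1 = R * y 1 := by
  obtain ⟨h0, h1⟩ := (cylRadius_eq_zero_iff x₀).1 hx₀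
  constructor
  · simp [h0]
  · simp [h1]

/-- The angular unit vector is invariant under the zoom about an axis point:
`e_θ(x₀ + R y) = e_θ(y)` for `R > 0` and `x₀` on the axis. [cite: SereginSverak2009, §3 p. 9 (cylindrical frame) and §4 p. 11] -/
theorem eTheta_axis_add_smul {x₀ : EuclideanSpace ℝ (Fin 3)} (hx₀ : cylRadius x₀ = 0) {R : ℝ}
    (hR : 0 < R) (y : EuclideanSpace ℝ (Fin 3)) : eTheta (x₀ + R • y) = eTheta y := by
  obtain ⟨h0, h1⟩ := apply_axis_add_smul hx₀ R y
  obtain ⟨hx0, hx1⟩ := (cylRadius_eq_zero_iff x₀).1 hx₀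
  have hr : cylRadius (x₀ + R • y) = R * cylRadius y := by
    rw [cylRadius_axis_add_smul hx0 hx1 R y, abs_of_pos hR]
  by_cases hy : cylRadius y = 0
  · obtain ⟨hy0, hy1⟩ := (cylRadius_eq_zero_iff y).1 hy
    have hz : cylRadius (x₀ + R • y) = 0 := by rw [hr, hy, mul_zero]
    ext i
    fin_cases i <;> simp [eTheta, hz, hy, h0, h1, hy0, hy1]
  · ext i
    fin_cases i
    · simp [eTheta, hr, h0, h1]
      field_simp
    · simp [eTheta, hr, h0, h1]
      field_simp
    · simp [eTheta]

/-- **The poloidal part commutes with the zoom about an axis point**: for `x₀` on the axis,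
`R > 0` and any `α`, `poloidalPart (y ↦ α u(x₀ + R y)) (y) = α · (poloidalPart u)(x₀ + R y)`
(because `e_θ(x₀ + R y) = e_θ(y)`). This is why hypothesis (1.1) passes to the rescaled fields
of §4. [cite: SereginSverak2009, §1 (1.1) and §4 p. 11] -/
theorem poloidalPart_axis_zoom {x₀ : EuclideanSpace ℝ (Fin 3)} (hx₀ : cylRadius x₀ = 0) {R : ℝ}
    (hR : 0 < R) (α : ℝ) (u : EuclideanSpace ℝ (Fin 3) → EuclideanSpace ℝ (Fin 3))
    (y : EuclideanSpace ℝ (Fin 3)) :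
    poloidalPart (fun y' => α • u (x₀ + R • y')) y = α • poloidalPart u (x₀ + R • y) := by
  simp only [poloidalPart_apply, swirlVelocity, eTheta_axis_add_smul hx₀ hR, inner_smul_left,
    RCLike.conj_to_real, smul_sub, smul_smul]

end Zoom

/-! ### The classical reading: axis points are regular under a Type I rate on `u_pol` alone -/

section Classical

open SereginSverak2009

variable {ν T : ℝ} {u : ℝ → EuclideanSpace ℝ (Fin 3) → EuclideanSpace ℝ (Fin 3)}
  {p : ℝ → EuclideanSpace ℝ (Fin 3) → ℝ}

/-- **Axis points are regular under the meridional Type I rate** (the classical reading of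
Seregin–Šverák 2009, Thm. 1.1, conditional on the named fact): under the Type-I-free standing
hypotheses `AxisymmetricL3Hyp ν T u p` (classical solution on `ℝ³ × [0, T)`, Leray–Hopf,
bounded on sub-slabs, axisymmetric) and the rate `√(T - t) ‖ū(t, x)‖ ≤ C` on the POLOIDAL part
for `0 ≤ t < T`, `u` is bounded on a backward parabolic neighbourhood of `(T, x₀)` for every
`x₀` on the axis. PROOF: the argument of `axisymmetric_typeI_boundedNearTop_axis_of_barrier`
(`AxisymmetricTypeIAxis.lean`) — gauged pressure, viscosity-normalising zoom
`v(s,y) = α u(T + βs, x₀ + Ry)` onto the unit cylinder, `L³`/`L^{3/2}` classes from the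
Type-I-free data (`AxisymmetricL3PressureBounds.lean`), axisymmetry — with two changes: (r2)
for `v` comes from the sub-slab bounds of `u`, and (1.1) for `v` from the poloidal rate of `u`
through `poloidalPart_axis_zoom`; the fact gives `IsRegularAtOrigin v`, transported back by
`AxisymmetricL3Hyp.isBoundedNearTop_of_eLpNorm_rescaled_lt_top`.
[cite: SereginSverak2009, Thm 1.1 (arXiv p. 3) with (1.1) (p. 2), §3–§4] -/
theorem SereginSverak2009.MeridionalTypeIRegularity.isBoundedNearTop_axis
    (hfact : MeridionalTypeIRegularity) (H : AxisymmetricL3Hyp ν T u p)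
    (hmer : ∃ C : ℝ, ∀ t ∈ Ico 0 T, ∀ x, Real.sqrt (T - t) * ‖poloidalPart (u t) x‖ ≤ C)
    (x₀ : EuclideanSpace ℝ (Fin 3)) (hx₀ : cylRadius x₀ = 0) : IsBoundedNearTop u T x₀ := by
  have hν := H.viscosity_pos
  have hT := H.time_pos
  -- scales: `R > 0` with `ρ = R (2 + 1/√ν) = √T / 2`
  set κ : ℝ := 2 + (Real.sqrt ν)⁻¹ with hκ
  have hκpos : 0 < κ := by positivity
  set R : ℝ := Real.sqrt T / (2 * κ) with hR
  have hRpos : 0 < R := by positivity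
  set ρ : ℝ := R * κ with hρ
  have hρT : ρ ^ 2 ≤ T := by
    have h1 : ρ = Real.sqrt T / 2 := by rw [hρ, hR]; field_simp
    rw [h1, div_pow, Real.sq_sqrt hT.le]; linarith
  set α : ℝ := R / ν with hα
  set β : ℝ := R ^ 2 / ν with hβdef
  have hαpos : 0 < α := by positivity
  have hβpos : 0 < β := by positivity
  have hβeq : β = α * R := by rw [hβdef, hα]; field_simp
  have hβρ : β ≤ ρ ^ 2 := by
    have h1 : β = (R * (Real.sqrt ν)⁻¹) ^ 2 := by
      rw [hβdef, mul_pow, inv_pow, Real.sq_sqrt hν.le, div_eq_mul_inv]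
    rw [h1, hρ]
    have h2 : (Real.sqrt ν)⁻¹ ≤ κ := by rw [hκ]; linarith
    exact pow_le_pow_left₀ (by positivity) (mul_le_mul_of_nonneg_left h2 hRpos.le) 2
  have hβT : β ≤ T := hβρ.trans hρT
  have h2Rρ : 2 * R ≤ ρ := by
    rw [hρ, hκ]
    have : 0 ≤ (Real.sqrt ν)⁻¹ := by positivity
    nlinarith
  -- the gauged pressure and the physical cylinder
  obtain ⟨q, hsuit, hqae, -⟩ := H.exists_gauged_pressure
  have hPopen := isOpen_image_stAffine_ssCylinder (T := T) (x₀ := x₀) hβpos.ne' hRpos.ne'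
  set PO : Opens (ℝ × EuclideanSpace ℝ (Fin 3)) := ⟨stAffine β R T x₀ '' ssCylinder, hPopen⟩
    with hPO
  have hPcyl : (PO : Set (ℝ × EuclideanSpace ℝ (Fin 3))) ⊆ parabolicCylinder ρ ((T : ℝ), x₀) :=
    image_stAffine_ssCylinder_subset hβpos hRpos hβρ h2Rρ
  have hcylslab : parabolicCylinder ρ ((T : ℝ), x₀) ⊆
      Ioo 0 T ×ˢ (univ : Set (EuclideanSpace ℝ (Fin 3))) := by
    intro z hz
    rw [mem_parabolicCylinder] at hz
    exact ⟨⟨by nlinarith [hz.1.1], hz.1.2⟩, mem_univ _⟩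
  have hPslab : (PO : Set (ℝ × EuclideanSpace ℝ (Fin 3))) ⊆
      Ioo 0 T ×ˢ (univ : Set (EuclideanSpace ℝ (Fin 3))) := hPcyl.trans hcylslab
  -- the rescaled pair solves the unit-viscosity system in distributions on the unit cylinder
  have hdist : IsDistributionalNSSolutionOn (parCylOpens 0 1) 1 0 (α • stPull β R T x₀ u)
      (α ^ 2 • stPull β R T x₀ q) := by
    have h0 := ((hsuit PO hPslab).distributional).stRescale hαpos hRpos hβeq T x₀
    have hvisc : α * ν / R = 1 := by
      rw [hα, div_mul_cancel₀ R hν.ne', div_self hRpos.ne']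
    have hforce : ((α ^ 2 * R) • stPull β R T x₀
        (0 : ℝ → EuclideanSpace ℝ (Fin 3) → EuclideanSpace ℝ (Fin 3))) = 0 := by
      funext s y; simp [stPull]
    rw [hvisc, hforce, stPreimage_image_ssCylinder hβpos.ne' hRpos.ne' hPopen,
      ssCylinderOpens_eq_parCylOpens] at h0
    exact h0
  -- `v ∈ L³(Q)`
  have hpre : stAffine β R T x₀ ⁻¹' (PO : Set (ℝ × EuclideanSpace ℝ (Fin 3))) = ssCylinder :=
    preimage_image_eq _ (injective_stAffine hβpos.ne' hRpos.ne' T x₀)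
  have hL3 : ∫⁻ z in parCyl 0 1, ‖(α • stPull β R T x₀ u) z.1 z.2‖ₑ ^ (3 : ℕ) < ∞ := by
    rw [← ssCylinder_eq_parCyl, ← hpre, setLIntegral_enorm_pow_stRescale hβpos hRpos T x₀ α u _ 3]
    refine ENNReal.mul_lt_top (ENNReal.mul_lt_top (ENNReal.pow_lt_top enorm_lt_top)
      ENNReal.ofReal_lt_top) ?_
    exact lt_of_le_of_lt (lintegral_mono_set hPcyl)
      (H.lintegral_cylinder_enorm_pow_three_lt_top hρT x₀)
  -- `π ∈ L^{3/2}(Q)`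
  have hL32 : ∫⁻ z in parCyl 0 1, ‖(α ^ 2 • stPull β R T x₀ q) z.1 z.2‖ₑ ^ (3 / 2 : ℝ) < ∞ := by
    rw [← ssCylinder_eq_parCyl, ← hpre,
      setLIntegral_enorm_rpow_stRescale hβpos hRpos T x₀ (α ^ 2) q _ (by norm_num)]
    refine ENNReal.mul_lt_top (ENNReal.mul_lt_top
      (ENNReal.rpow_lt_top_of_nonneg (by norm_num) enorm_ne_top) ENNReal.ofReal_lt_top) ?_
    exact lt_of_le_of_lt (lintegral_mono_set hPcyl)
      (H.lintegral_cylinder_gauged_pressure_lt_top hqae hρT x₀)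
  -- rescaled times lie in `[0, T)`
  have htime : ∀ s : ℝ, s ∈ Ioo (-1 : ℝ) 0 → T + β * s ∈ Ico 0 T := by
    intro s hs
    constructor
    · nlinarith [hs.1]
    · nlinarith [hs.2]
  -- axisymmetry of the rescaled slices (`x₀` is fixed by the rotations, which are linear)
  have haxi : ∀ s ∈ Ioo (-1 : ℝ) 0, IsAxisymmetric ((α • stPull β R T x₀ u) s) := by
    intro s hs θ y
    simp only [smul_stPull_apply]
    rw [show x₀ + R • rotZ θ y = rotZ θ (x₀ + R • y) by
      rw [SereginSverak2009.rotZ_add_vec, SereginSverak2009.rotZ_smul_vec,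
        rotZ_eq_self_of_cylRadius_eq_zero θ hx₀],
      H.axisymmetric _ (htime s hs) θ, SereginSverak2009.rotZ_smul_vec]
  have hloc : IsAxisymmetricLocalSolution (α • stPull β R T x₀ u) (α ^ 2 • stPull β R T x₀ q) :=
    ⟨hdist, hL3, hL32, haxi⟩
  -- (r2) for the rescaled field, from the sub-slab bounds of `u`
  have hr2 : IsBoundedAwayFromZero (α • stPull β R T x₀ u) := by
    intro a ha
    have hβa : 0 < β * a ^ 2 := mul_pos hβpos (pow_pos ha.1 2)
    obtain ⟨M, hM⟩ := H.bounded_subslab (T - β * a ^ 2) (by linarith)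
    refine ⟨α * M, (ae_restrict_mem (isOpen_parCyl 0 1).measurableSet).mono ?_⟩
    intro z hz hza
    obtain ⟨hs, -, -⟩ := mem_parCyl_zero.1 hz
    have ht : T + β * z.1 ∈ Icc 0 (T - β * a ^ 2) := by
      constructor
      · have := (htime z.1 (by simpa using hs)).1
        exact this
      · nlinarith [hza]
    rw [smul_stPull_apply, norm_smul, Real.norm_of_nonneg hαpos.le]
    exact mul_le_mul_of_nonneg_left (hM _ ht _) hαpos.le
  -- (1.1) for the rescaled field, from the poloidal rate of `u`
  obtain ⟨C, hC⟩ := hmer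
  have hmerv : IsMeridionalTypeIOnCyl (α • stPull β R T x₀ u) := by
    refine ⟨α / Real.sqrt β * C, (ae_restrict_mem (isOpen_parCyl 0 1).measurableSet).mono ?_⟩
    intro z hz
    obtain ⟨hs, -, -⟩ := mem_parCyl_zero.1 hz
    have hs' : z.1 ∈ Ioo (-1 : ℝ) 0 := by simpa using hs
    have hτ := htime z.1 hs'
    have hrate := hC _ hτ (x₀ + R • z.2)
    have hsq : Real.sqrt (T - (T + β * z.1)) = Real.sqrt β * Real.sqrt (-z.1) := by
      rw [show T - (T + β * z.1) = β * (-z.1) by ring, Real.sqrt_mul hβpos.le]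
    rw [hsq] at hrate
    have hsβ : 0 < Real.sqrt β := Real.sqrt_pos.2 hβpos
    have hpol : poloidalPart ((α • stPull β R T x₀ u) z.1) z.2 =
        α • poloidalPart (u (T + β * z.1)) (x₀ + R • z.2) := by
      have hfun : (α • stPull β R T x₀ u) z.1 = fun y' => α • u (T + β * z.1) (x₀ + R • y') := by
        funext y'; rfl
      rw [hfun, poloidalPart_axis_zoom hx₀ hRpos]
    rw [hpol, norm_smul, Real.norm_of_nonneg hαpos.le]
    calc Real.sqrt (-z.1) * (α * ‖poloidalPart (u (T + β * z.1)) (x₀ + R • z.2)‖)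
        = α / Real.sqrt β *
            (Real.sqrt β * Real.sqrt (-z.1) * ‖poloidalPart (u (T + β * z.1)) (x₀ + R • z.2)‖) := by
          field_simp
      _ ≤ α / Real.sqrt β * C := mul_le_mul_of_nonneg_left hrate (by positivity)
  -- the fact: regularity of the origin for the rescaled field, transported back
  obtain ⟨r, hr, hbd⟩ := exists_eLpNorm_parabolicCylinder_lt_top_of_isRegularAtOrigin
    (hfact _ _ hloc hr2 hmerv)
  exact H.isBoundedNearTop_of_eLpNorm_rescaled_lt_top x₀ hαpos hβpos hRpos hr hbd

/-- **Boundedness up to the final time under the meridional Type I rate** (conditional on the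
fact): with the axis input above, the tree's Type-I-free off-axis input
(`axisymmetricL3_boundedNearTop_offAxis`, CKN) and spatial-infinity input
(`axisymmetricL3_boundedNearTop_infinity`, one-scale ε-regularity) and the compactness glue
(`exists_bound_final_slab`, `exists_bound_Ico_of_final_slab`), `u` is bounded on `[0, T) × ℝ³`.
[cite: SereginSverak2009, Thm 1.1 (arXiv p. 3); KochNadirashviliSereginSverak2009, Thm 6.2] -/
theorem SereginSverak2009.MeridionalTypeIRegularity.exists_bound_Ico
    (hfact : MeridionalTypeIRegularity) (H : AxisymmetricL3Hyp ν T u p)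
    (hmer : ∃ C : ℝ, ∀ t ∈ Ico 0 T, ∀ x, Real.sqrt (T - t) * ‖poloidalPart (u t) x‖ ≤ C) :
    ∃ M : ℝ, ∀ t ∈ Ico 0 T, ∀ x, ‖u t x‖ ≤ M := by
  have hloc : ∀ x₀ : EuclideanSpace ℝ (Fin 3), IsBoundedNearTop u T x₀ := fun x₀ => by
    by_cases h0 : cylRadius x₀ = 0
    · exact hfact.isBoundedNearTop_axis H hmer x₀ h0
    · exact axisymmetricL3_boundedNearTop_offAxis H x₀ h0
  obtain ⟨R, r₁, K₁, hr₁, hfar⟩ := axisymmetricL3_boundedNearTop_infinity H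
  obtain ⟨r₀, hr₀, K, hK⟩ := exists_bound_final_slab hloc hr₁ hfar
  exact exists_bound_Ico_of_final_slab H.bounded_subslab hr₀ hK

/-- **No blow-up under a Type I rate on the poloidal velocity alone** (Seregin–Šverák 2009,
Thm. 1.1 read globally, conditional on the named fact `MeridionalTypeIRegularity`; cf. KNSS 2009,
Thm. 6.2, where the rate is on the full velocity — `knss_no_axisymmetric_typeI`, DISCHARGED). Let
`ν > 0`, `T > 0`, `(u, p)` a classical Navier–Stokes solution (`f = 0`) on `ℝ³ × [0, T)`,
Leray–Hopf on `[0, T)` from `u 0`, bounded on `ℝ³ × [0, T']` for every `T' < T`, with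
axisymmetric slices, and suppose only the POLOIDAL part obeys the Type I rate,
`√(T - t) ‖ū(t, x)‖ ≤ C` for `0 ≤ t < T`. Then `u` extends as a classical solution past `T`
(`exists_bound_Ico` and the continuation of bounded Leray–Hopf solutions,
`hasSmoothExtensionPast_of_bounded_holds`). No hypothesis on the swirl is needed.
[cite: SereginSverak2009, Thm 1.1 (arXiv p. 3) with (1.1) (p. 2)] -/
theorem SereginSverak2009.MeridionalTypeIRegularity.hasSmoothExtensionPast
    (hfact : MeridionalTypeIRegularity) (hν : 0 < ν) (hT : 0 < T)
    (h : IsClassicalNSSolutionOn (Ico 0 T) ν 0 u p) (hLH : IsLerayHopfOn T ν 0 (u 0) u)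
    (hbdd : ∀ T' < T, ∃ M : ℝ, ∀ t ∈ Icc 0 T', ∀ x, ‖u t x‖ ≤ M)
    (haxi : ∀ t ∈ Ico 0 T, IsAxisymmetric (u t))
    (hmer : ∃ C : ℝ, ∀ t ∈ Ico 0 T, ∀ x, Real.sqrt (T - t) * ‖poloidalPart (u t) x‖ ≤ C) :
    HasSmoothExtensionPast ν 0 u T :=
  hasSmoothExtensionPast_of_bounded_holds hν hT h hLH
    (hfact.exists_bound_Ico ⟨hν, hT, h, hLH, hbdd, haxi⟩ hmer)

/-- **The same with the rate in the tree's `IsTypeIBlowup` spelling, applied to the poloidal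
field** `(t, x) ↦ ū(t, x)`: `∃ C, ∀ᶠ t → T⁻, ∀ x, ‖ū(t,x)‖ ≤ C/√(T - t)`; on `[0, T₁]` the poloidal
part is bounded with `u` (`‖ū‖ ≤ ‖u‖`), so the rate holds on all of `[0, T)`
(`IsTypeIBlowup.exists_sqrt_mul_norm_le`). [cite: SereginSverak2009, Thm 1.1 (arXiv p. 3) with (1.1) (p. 2)] -/
theorem SereginSverak2009.MeridionalTypeIRegularity.hasSmoothExtensionPast_of_isTypeIBlowup_poloidal
    (hfact : MeridionalTypeIRegularity) (hν : 0 < ν) (hT : 0 < T)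
    (h : IsClassicalNSSolutionOn (Ico 0 T) ν 0 u p) (hLH : IsLerayHopfOn T ν 0 (u 0) u)
    (hbdd : ∀ T' < T, ∃ M : ℝ, ∀ t ∈ Icc 0 T', ∀ x, ‖u t x‖ ≤ M)
    (haxi : ∀ t ∈ Ico 0 T, IsAxisymmetric (u t))
    (hI : IsTypeIBlowup (fun t x => poloidalPart (u t) x) T) :
    HasSmoothExtensionPast ν 0 u T := by
  have hbdd' : ∀ T' < T, ∃ M : ℝ, ∀ t ∈ Icc 0 T', ∀ x,
      ‖(fun t x => poloidalPart (u t) x) t x‖ ≤ M := by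
    intro T' hT'
    obtain ⟨M, hM⟩ := hbdd T' hT'
    exact ⟨M, fun t ht x => (norm_poloidalPart_le (u t) x).trans (hM t ht x)⟩
  exact hfact.hasSmoothExtensionPast hν hT h hLH hbdd haxi (hI.exists_sqrt_mul_norm_le hbdd')

/-- **Kill form**: at a genuine lifespan `T` (`IsMaximalSmoothSolution`) of a classical
axisymmetric Leray–Hopf solution bounded on sub-slabs, the weighted poloidal velocity
`√(T - t) ‖ū(t, x)‖` is unbounded on `[0, T) × ℝ³` — conditional on the named fact. This is the
statement against which an axisymmetric numerical blow-up candidate printing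
`√(T_fit - t)·‖u_pol‖_∞` is read. [cite: SereginSverak2009, Thm 1.1 (arXiv p. 3) with (1.1) (p. 2)] -/
theorem SereginSverak2009.MeridionalTypeIRegularity.exists_sqrt_mul_norm_poloidal_gt
    (hfact : MeridionalTypeIRegularity) (hν : 0 < ν) (hT : 0 < T)
    (hmax : IsMaximalSmoothSolution ν 0 u p T) (hLH : IsLerayHopfOn T ν 0 (u 0) u)
    (hbdd : ∀ T' < T, ∃ M : ℝ, ∀ t ∈ Icc 0 T', ∀ x, ‖u t x‖ ≤ M)
    (haxi : ∀ t ∈ Ico 0 T, IsAxisymmetric (u t)) (C : ℝ) :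
    ∃ t ∈ Ico 0 T, ∃ x, C < Real.sqrt (T - t) * ‖poloidalPart (u t) x‖ := by
  by_contra hcon
  push Not at hcon
  exact hmax.2 (hfact.hasSmoothExtensionPast hν hT hmax.1 hLH hbdd haxi ⟨C, hcon⟩)

end Classical

end Literature.Analysis.FluidPDE

end
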